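import Summits.ABC.IUTFork.Conditional.AbcOfSHwBadMShallowReyssat
import Summits.ABC.IUTFork.Conditional.AbcOfSHwBadMOfRefuted
import Summits.ABC.IUTFork.Conditional.AbcOfSGenuineMChosenDepthRadRowsReyssat
import Summits.ABC.ABC.Theorems.IUTThetaPilotThetaPartIIStubThetaData
import Mathlib.Analysis.Real.Pi.Bounds
import HarnessLib

/-!
# Branch C, M line — THE M APEX AT THE REYSSAT DATUM: the M window binder `hSHwBad` of `abc_of_SH_v11M_window_szpiroBadAll` (p453767, TYPE VERBATIM)
# is FALSE at `(ratPoint (2/23⁵), 13)` MODULO ONLY (P6) — the M twin of the tier-1 K apex `not_hSHwBad_frey` (p467486)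

C scoreboard (abc-iut-C-cert-3 gen 4, INTAKE / CERTS pen; row «C:M-WINDOW-REYSSAT», part 2 of 2). PROOF-ONLY composition (no `def`, no new `Prop`,
no instance, no notation; nothing re-typed: the conclusion is the socket `not_hSHwBad_M_of_refuted`'s (p468391 §1), i.e. p453767's binder VERBATIM).

* §4 admissibility AS TYPED at `(ratPoint (2/23⁵), 13)` — `ReyssatM.mem_UP`, `.admitsCore`, `.condP2` (`13 ∤ 20, 10, 2`), `.condP5` (the place over `3`),
  the SZPIRO-BAD GUARD `ReyssatM.szpiroBad` (the records' disjunction VERBATIM: `d_mod = 1`, `log-diff = 0`, abc-iut-s2-p4's exact sums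
  `log q^{∤{2,13}} = 20 log 3 + 10 log 23 + 2 log 109`, `log 𝔣^{∤{2,13}} = log 3 + log 23 + log 109`, and ONE integer inequality
  `63⁷⁰²·109³³⁴ < 3¹¹⁹⁶·23³⁴⁶·20⁷⁰²` with `π < 3.15` — margin ≈ 0.3 nats; `π < 4` would not do), and `ReyssatM.nonempty_thetaVolumeDatumAt` (from (P6)).
* §5 **`not_hSHwBad_M_reyssat_thirteen (h6 : Cor22.CondP6 (ratPoint (2/23⁵)) 13) : ¬ hSHwBad_M`** — the socket fed with §4, the M-shallowness theorem
  `ReyssatM.not_exists_deep_thirteen` (part 1) and abc-iut-W-num-6's UNCONDITIONAL M-line RAD refutation `GenuineM.not_pilotKummerCompatHull_reyssat_le_19_rad`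
  over `23` (`AbcOfSGenuineMChosenDepthRadRowsReyssat`). FIRST refutation of the M WINDOW binder at a known datum (modulo (P6)); a (P6) certificate at
  `ratPoint (2/23⁵)` in the C-R66 «C:P6-ENGINE» pattern makes it unconditional, after which the M window family p445989 → p453767 becomes a COMPOSITION
  RECORD like the K family (FINDINGS §N/§P). Whether the θ-content M record p461893 (same binder restricted to the CONTENT locus) is engaged at this datum
  is NOT examined here.

HONEST FRAMING: refutes a binder of OUR typed M certificates (sharp M setting; per-label licence STRONGER than print's (xi-f)); refuted-as-typed ≠
refuted-in-print; (P6) is NOT proved here; nothing asserts that abc is proved or refuted, or that [IUTchIII] Cor. 3.12 / [IUTchIV] Thm. 1.10 holds or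
fails at any datum, or takes a side on any author; typed ≠ proved; instantiated ≠ endorsed.
[cite: Mochizuki2012, IUTchIII Cor. 3.12 p. 173–174, Step (xi-f) p. 184; IUTchIV Thm. 1.10 p. 22–23, Cor. 2.2 (ii) proof (P2)(P5)(P6)(P7) p. 43–46]
[cite: MochizukiGenEll2010, Ex. 1.3 (i) p. 5, Def. 3.3 p. 12] [claim: Mochizuki2012, status: disputed] for every IUT sentence quoted.
-/

noncomputable section

open Set Function NumberField IsDedekindDomain

namespace Summit.ABC.IUTFork.Conditional

open Thm311 Thm311.Real Cor312 Cor312Vol Cor312Prov Literature.IUT.LogThetaLattice Literature.IUT.LogVolume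
  Literature.IUT.HodgeTheaters Literature.IUT.LogVolume.ThetaData Literature.IUT.LogVolume.Cor22
open Literature.NumberTheory.NumberFields Literature.NumberTheory.GaloisRepresentations.Ultrametric
open Literature.NumberTheory.DiophantineGeometry Literature.NumberTheory.DiophantineGeometry.GenEll Summit.ABC.ABC.Theorems


/-! ## §4. Admissibility AS TYPED and the Szpiro-bad guard at `(ratPoint (2/23⁵), 13)` (classical arithmetic of the triple) -/

/-- `λ = 2/23⁵ ∈ U_P(ℚ)`. [cite: MochizukiGenEll2010, Ex. 1.3 (i) p. 5] -/
theorem ReyssatM.mem_UP : (ratPoint (((2 : ℕ) : ℚ) / (23 ^ 5 : ℕ))) ∈ UP := (ratPoint_mem_UPle_one (by norm_num) (by norm_num)).1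

/-- `AdmitsCore`: `j(2/23⁵)` is none of the four exceptional values. [cite: Mochizuki2012, IUTchIV Cor. 2.2 (ii) proof p. 43] [claim: Mochizuki2012, status: disputed] -/
theorem ReyssatM.admitsCore : Cor22.AdmitsCore (ratPoint (((2 : ℕ) : ℚ) / (23 ^ 5 : ℕ))) := by
  intro q hq
  simp only [Cor22.coreExceptionalJ, Finset.mem_insert, Finset.mem_singleton] at hq
  change Cor22.jInv (((2 : ℕ) : ℚ) / (23 ^ 5 : ℕ)) ≠ q
  rw [ReyssatM.jInv_eq]
  rcases hq with rfl | rfl | rfl | rfl <;> norm_num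

/-- **(P2) at `l = 13`**: `13` divides no nonzero local height (`h_p ∈ {20, 10, 2}`). [cite: Mochizuki2012, IUTchIV Cor. 2.2 (ii) proof (P2) p. 45]
[claim: Mochizuki2012, status: disputed] -/
theorem ReyssatM.condP2 : Cor22.CondP2 (ratPoint (((2 : ℕ) : ℚ) / (23 ^ 5 : ℕ))) 13 := by
  have key : ∀ w : HeightOneSpectrum (𝓞 ℚ), ord ℚ w (Cor22.jInv (((2 : ℕ) : ℚ) / (23 ^ 5 : ℕ))) < 0 →
      ¬ ((13 : ℤ) ∣ ord ℚ w (Cor22.jInv (((2 : ℕ) : ℚ) / (23 ^ 5 : ℕ)))) := by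
    intro w hneg
    by_cases hw : Rat.HeightOneSpectrum.natGenerator w ∈ ({3, 23, 109} : Finset ℕ)
    · rw [ReyssatM.ord_jInv_of_mem w hw]
      simp only [Finset.mem_insert, Finset.mem_singleton] at hw
      rcases hw with h | h | h <;> (rw [h]; norm_num)
    · exact absurd hneg (not_lt.mpr (ReyssatM.ord_jInv_nonneg_of_not_mem w hw))
  intro v hneg
  exact key v hneg

/-- **(P5) at `l = 13`**: the place over `3` is bad and divides neither `2` nor `13`. [cite: Mochizuki2012, IUTchIV Cor. 2.2 (ii) proof (P5) p. 46]
[claim: Mochizuki2012, status: disputed] -/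
theorem ReyssatM.condP5 : Cor22.CondP5 (ratPoint (((2 : ℕ) : ℚ) / (23 ^ 5 : ℕ))) 13 := by
  have hgen : Rat.HeightOneSpectrum.natGenerator ((Rat.HeightOneSpectrum.primesEquiv (R := 𝓞 ℚ)).symm ⟨3, by norm_num⟩) = 3 :=
    congrArg Subtype.val ((Rat.HeightOneSpectrum.primesEquiv (R := 𝓞 ℚ)).apply_symm_apply ⟨3, by norm_num⟩)
  have key : ∃ w : HeightOneSpectrum (𝓞 ℚ), ord ℚ w (Cor22.jInv (((2 : ℕ) : ℚ) / (23 ^ 5 : ℕ))) < 0 ∧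
      ((2 : ℕ) : 𝓞 ℚ) ∉ w.asIdeal ∧ ((13 : ℕ) : 𝓞 ℚ) ∉ w.asIdeal := by
    refine ⟨(Rat.HeightOneSpectrum.primesEquiv (R := 𝓞 ℚ)).symm ⟨3, by norm_num⟩, ?_, ?_, ?_⟩
    · rw [ReyssatM.ord_jInv_of_mem _ (by rw [hgen]; simp), hgen]
      norm_num
    · rw [UniformABCConjecture.natCast_mem_asIdeal_iff, hgen]; norm_num
    · rw [UniformABCConjecture.natCast_mem_asIdeal_iff, hgen]; norm_num
  obtain ⟨w, h1, h2, h3⟩ := key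
  exact ⟨w, h1, h2, h3⟩

set_option exponentiation.threshold 10000 in
/-- The integer certificate behind the guard: `63⁷⁰²·109³³⁴ < 3¹¹⁹⁶·23³⁴⁶·20⁷⁰²` (so `702·log(63/20) < 1196·log 3 + 346·log 23 − 334·log 109`). [folklore] -/
theorem ReyssatM.key_ineq : (63 : ℕ) ^ 702 * 109 ^ 334 < 3 ^ 1196 * 23 ^ 346 * 20 ^ 702 := by
  norm_num

/-- Log form: `702·log π < 1196·log 3 + 346·log 23 − 334·log 109` (`π < 3.15 = 63/20`, Mathlib `Real.pi_lt_d2`). [folklore] -/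
theorem ReyssatM.key_ineq_log : 702 * Real.log Real.pi < 1196 * Real.log 3 + 346 * Real.log 23 - 334 * Real.log 109 := by
  have hpi : Real.log Real.pi < Real.log 63 - Real.log 20 := by
    have h := Real.log_lt_log Real.pi_pos Real.pi_lt_d2
    rw [show (3.15 : ℝ) = 63 / 20 by norm_num, Real.log_div (by norm_num) (by norm_num)] at h
    exact h
  have hk : Real.log ((63 : ℕ) ^ 702 * 109 ^ 334 : ℕ) < Real.log ((3 : ℕ) ^ 1196 * 23 ^ 346 * 20 ^ 702 : ℕ) :=
    Real.log_lt_log (by positivity) (by exact_mod_cast ReyssatM.key_ineq)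
  simp only [Nat.cast_mul, Nat.cast_pow, Nat.cast_ofNat] at hk
  rw [Real.log_mul (by positivity) (by positivity), Real.log_mul (by positivity) (by positivity),
    Real.log_mul (by positivity) (by positivity), Real.log_pow, Real.log_pow, Real.log_pow, Real.log_pow, Real.log_pow] at hk
  push_cast at hk
  linarith

/-- **`(ratPoint (2/23⁵), 13)` is SZPIRO-BAD** — the records' guard disjunction VERBATIM (`P ↦ ratPoint λ`, `l ↦ 13`), right disjunct: `d_mod = 1`,
`log-diff = 0`, `log q^{∤{2,13}} = 20 log 3 + 10 log 23 + 2 log 109`, `log 𝔣^{∤{2,13}} = log 3 + log 23 + log 109` (abc-iut-s2-p4's exact sums) and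
`(504/85)·log 𝔣 + (702/85)·log π < log q` from `key_ineq_log`. Margin ≈ 0.3 nats: `π < 4` would NOT do. [cite: Mochizuki2012, IUTchIV Thm. 1.10 p. 22–23]
[claim: Mochizuki2012, status: disputed] -/
theorem ReyssatM.szpiroBad :
    (((13 : ℕ) : ℝ) + 5) / 4 < (Cor22.dmod (ratPoint (((2 : ℕ) : ℚ) / (23 ^ 5 : ℕ))) : ℝ) ∨
      6 * (13 : ℕ) * ((((13 : ℕ) : ℝ) + 5) - 4 * Cor22.dmod (ratPoint (((2 : ℕ) : ℚ) / (23 ^ 5 : ℕ)))) / ((((13 : ℕ) : ℝ) + 4) * (((13 : ℕ) : ℝ) - 3))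
          * ((ratPoint (((2 : ℕ) : ℚ) / (23 ^ 5 : ℕ))).logDiff + (1 - 1 / ((13 : ℕ) : ℝ)) * Cor22.logCondAvoid (ratPoint (((2 : ℕ) : ℚ) / (23 ^ 5 : ℕ))) {2, 13})
        + 6 * (13 : ℕ) * (((13 : ℕ) : ℝ) + 5) / ((((13 : ℕ) : ℝ) + 4) * (((13 : ℕ) : ℝ) - 3)) * Real.log Real.pi <
        Cor22.logQAvoid (ratPoint (((2 : ℕ) : ℚ) / (23 ^ 5 : ℕ))) {2, 13} := by
  right
  have hq : (((2 : ℕ) : ℚ) / (23 ^ 5 : ℕ)) = (2 : ℚ) / 6436343 := by norm_num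
  have hdmod : Cor22.dmod (ratPoint (((2 : ℕ) : ℚ) / (23 ^ 5 : ℕ))) = 1 := Cor22.dmod_eq_one_of_degree_le_one (degree_ratPoint _).le
  rw [hdmod, logDiff_ratPoint, hq, Cor22.logCondAvoid_reyssat (by norm_num) (by norm_num) (by norm_num) (by norm_num),
    Cor22.logQAvoid_reyssat (by norm_num) (by norm_num) (by norm_num) (by norm_num)]
  have hkey := ReyssatM.key_ineq_log
  have h3 : 0 < Real.log 3 := Real.log_pos (by norm_num)
  have h23 : 0 < Real.log 23 := Real.log_pos (by norm_num)
  have h109 : 0 < Real.log 109 := Real.log_pos (by norm_num)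
  push_cast
  nlinarith [hkey, h3, h23, h109]

/-- **The datum type at `(ratPoint (2/23⁵), 13)` is INHABITED, given (P6)** (`ThetaPartII.stub_thetaData` at the admissible pair).
[cite: Mochizuki2012, IUTchIV Cor. 2.2 (ii) proof (P7) p. 46] [claim: Mochizuki2012, status: disputed] -/
theorem ReyssatM.nonempty_thetaVolumeDatumAt (h6 : Cor22.CondP6 (ratPoint (((2 : ℕ) : ℚ) / (23 ^ 5 : ℕ))) 13) :
    Nonempty (Cor22.ThetaVolumeDatumAt (ratPoint (((2 : ℕ) : ℚ) / (23 ^ 5 : ℕ))) 13) :=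
  ThetaPartII.stub_thetaData (ratPoint (((2 : ℕ) : ℚ) / (23 ^ 5 : ℕ))) ReyssatM.mem_UP 13 (by norm_num) (by norm_num) ReyssatM.admitsCore
    ReyssatM.condP2 ReyssatM.condP5 h6

/-! ## §5. THE M APEX AT THE REYSSAT DATUM: `¬ hSHwBad_M` from (P6) at `(ratPoint (2/23⁵), 13)` ALONE -/

/-- **`¬ hSHwBad_M` AT THE REYSSAT DATUM `2 + 3¹⁰·109 = 23⁵`, `l = 13`, MODULO ONLY (P6).** For every family of the free context binders and Kummer
data, the hypothesis `hSHwBad` of the M window certificate `Conditional.abc_of_SH_v11M_window_szpiroBadAll` (p453767; TYPE VERBATIM — the conclusion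
of this seat's socket `not_hSHwBad_M_of_refuted`, p468391 §1) is FALSE, given `Cor22.CondP6 (ratPoint (2/23⁵)) 13` (the Galois-image condition, by NAME):
the socket fed with admissibility AS TYPED (§4: `ReyssatM.mem_UP/admitsCore/condP2/condP5`), the Szpiro-bad guard (`ReyssatM.szpiroBad`, margin ≈ 0.3
nats, `π < 3.15`), M-SHALLOWNESS of every member (§3, `ReyssatM.not_exists_deep_thirteen`), abc-iut-W-num-6's UNCONDITIONAL M-line RAD refutation
`GenuineM.not_pilotKummerCompatHull_reyssat_le_19_rad` over `23` (p477727 `AbcOfSGenuineMChosenDepthRadRowsReyssat`; its socket instantiation with the inputs BY NAME is abc-iut-W-num-6's `not_hSHwBad_M_of_reyssat_thirteen_inputs`, `AbcOfSHwBadMOfRefutedReyssat` — this file DISCHARGES every one of those inputs except (P6)), and non-emptiness from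
`ThetaPartII.stub_thetaData` at (P6). This is the M twin of the tier-1 K apex `not_hSHwBad_frey` (p467486) BEFORE its (P6) discharge: the FIRST refutation of
the M WINDOW binder at a known datum, modulo (P6). A (P6) certificate at `ratPoint (2/23⁵)` (C-R66 «C:P6-ENGINE» pattern) makes it unconditional.
HONEST FRAMING: refutes a binder of OUR typed M certificates (sharp M setting, per-label licence STRONGER than print's (xi-f)); refuted-as-typed ≠
refuted-in-print; the θ-content M record p461893 has the SAME window binder restricted to the content locus — whether (ratPoint (2/23⁵), 13) lies on the
content locus is NOT examined here; nothing asserts that abc is proved or refuted or takes a side on any author; typed ≠ proved.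
[cite: Mochizuki2012, IUTchIII Cor. 3.12 Step (xi-f) p. 184; IUTchIV Thm. 1.10 p. 22–23, Cor. 2.2 (ii) proof (P2)(P5)(P6)(P7) p. 43–46]
[claim: Mochizuki2012, status: disputed] -/
theorem not_hSHwBad_M_reyssat_thirteen
    (M : ∀ (P : NFPoint) (l : ℕ) (T : Cor22.ThetaVolumeDatumAt P l), Type) [∀ P l T, Field (M P l T)] [∀ P l T, NumberField (M P l T)]
    (archPk : ∀ (P : NFPoint) (l : ℕ) (T : Cor22.ThetaVolumeDatumAt P l), letI := T.instFieldF; letI := T.instNumberFieldF; letI := T.instAlgebraF; letI := T.instFieldK;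
        letI := T.instNumberFieldK; letI := T.instAlgebraK; letI := T.instFieldFbar; letI := T.instAlgebraFbar;
        letI := T.instAlgebraKFbar; letI := T.instIsElliptic;
      ∀ (j : (thetaIndexOfInitial T.D).Label) (vQ : (thetaIndexOfInitial T.D).VQ), Set ((logShellsOfInitialDH T.D (analyticLogvVal T.K)).Packet j vQ))
    (archSub : ∀ (P : NFPoint) (l : ℕ) (T : Cor22.ThetaVolumeDatumAt P l), letI := T.instFieldF; letI := T.instNumberFieldF; letI := T.instAlgebraF; letI := T.instFieldK;
        letI := T.instNumberFieldK; letI := T.instAlgebraK; letI := T.instFieldFbar; letI := T.instAlgebraFbar;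
        letI := T.instAlgebraKFbar; letI := T.instIsElliptic;
      ∀ (j : (thetaIndexOfInitial T.D).Label) (v : (thetaIndexOfInitial T.D).V), Set ((logShellsOfInitialDH T.D (analyticLogvVal T.K)).Packet j ((thetaIndexOfInitial T.D).over v)))
    (Ψ : ∀ (P : NFPoint) (l : ℕ) (T : Cor22.ThetaVolumeDatumAt P l), letI := T.instFieldF; letI := T.instNumberFieldF; letI := T.instAlgebraF; letI := T.instFieldK;
        letI := T.instNumberFieldK; letI := T.instAlgebraK; letI := T.instFieldFbar; letI := T.instAlgebraFbar;
        letI := T.instAlgebraKFbar; letI := T.instIsElliptic;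
      ℤ → ∀ v : (thetaIndexOfInitial T.D).V, v ∈ (thetaIndexOfInitial T.D).Vbad → Set ((logShellsOfInitialDH T.D (analyticLogvVal T.K)).StarPacket v))
    (act : ∀ (P : NFPoint) (l : ℕ) (T : Cor22.ThetaVolumeDatumAt P l), letI := T.instFieldF; letI := T.instNumberFieldF; letI := T.instAlgebraF; letI := T.instFieldK;
        letI := T.instNumberFieldK; letI := T.instAlgebraK; letI := T.instFieldFbar; letI := T.instAlgebraFbar;
        letI := T.instAlgebraKFbar; letI := T.instIsElliptic;
      ℤ → ∀ v : (thetaIndexOfInitial T.D).V, v ∈ (thetaIndexOfInitial T.D).Vbad → (logShellsOfInitialDH T.D (analyticLogvVal T.K)).StarPacket v → Module.End ℚ ((logShellsOfInitialDH T.D (analyticLogvVal T.K)).StarPacket v))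
    (Mmod : ∀ (P : NFPoint) (l : ℕ) (T : Cor22.ThetaVolumeDatumAt P l), letI := T.instFieldF; letI := T.instNumberFieldF; letI := T.instAlgebraF; letI := T.instFieldK;
        letI := T.instNumberFieldK; letI := T.instAlgebraK; letI := T.instFieldFbar; letI := T.instAlgebraFbar;
        letI := T.instAlgebraKFbar; letI := T.instIsElliptic;
      ℤ → ∀ j : (thetaIndexOfInitial T.D).LabelStar, Set ((logShellsOfInitialDH T.D (analyticLogvVal T.K)).GlobalPacket j.1))
    (region : ∀ (P : NFPoint) (l : ℕ) (T : Cor22.ThetaVolumeDatumAt P l), letI := T.instFieldF; letI := T.instNumberFieldF; letI := T.instAlgebraF; letI := T.instFieldK;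
        letI := T.instNumberFieldK; letI := T.instAlgebraK; letI := T.instFieldFbar; letI := T.instAlgebraFbar;
        letI := T.instAlgebraKFbar; letI := T.instIsElliptic;
      ℤ → ∀ j : (thetaIndexOfInitial T.D).LabelStar, FinDivisor (M P l T) → ∀ vQ : (thetaIndexOfInitial T.D).VQ, Set ((logShellsOfInitialDH T.D (analyticLogvVal T.K)).Packet j.1 vQ))
    (frobAdm : ∀ (P : NFPoint) (l : ℕ) (T : Cor22.ThetaVolumeDatumAt P l), letI := T.instFieldF; letI := T.instNumberFieldF; letI := T.instAlgebraF; letI := T.instFieldK;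
        letI := T.instNumberFieldK; letI := T.instAlgebraK; letI := T.instFieldFbar; letI := T.instAlgebraFbar;
        letI := T.instAlgebraKFbar; letI := T.instIsElliptic;
      ℤ → ℤ → ∀ (j : (thetaIndexOfInitial T.D).Label) (vQ : (thetaIndexOfInitial T.D).VQ), Set ((logShellsOfInitialDH T.D (analyticLogvVal T.K)).Packet j vQ) → Prop)
    (frobLogvol : ∀ (P : NFPoint) (l : ℕ) (T : Cor22.ThetaVolumeDatumAt P l), letI := T.instFieldF; letI := T.instNumberFieldF; letI := T.instAlgebraF; letI := T.instFieldK;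
        letI := T.instNumberFieldK; letI := T.instAlgebraK; letI := T.instFieldFbar; letI := T.instAlgebraFbar;
        letI := T.instAlgebraKFbar; letI := T.instIsElliptic;
      ℤ → ℤ → ∀ (j : (thetaIndexOfInitial T.D).Label) (vQ : (thetaIndexOfInitial T.D).VQ), Set ((logShellsOfInitialDH T.D (analyticLogvVal T.K)).Packet j vQ) → ℝ)
    (frobΨ : ∀ (P : NFPoint) (l : ℕ) (T : Cor22.ThetaVolumeDatumAt P l), letI := T.instFieldF; letI := T.instNumberFieldF; letI := T.instAlgebraF; letI := T.instFieldK;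
        letI := T.instNumberFieldK; letI := T.instAlgebraK; letI := T.instFieldFbar; letI := T.instAlgebraFbar;
        letI := T.instAlgebraKFbar; letI := T.instIsElliptic;
      ℤ → ℤ → ∀ v : (thetaIndexOfInitial T.D).V, v ∈ (thetaIndexOfInitial T.D).Vbad → Set ((logShellsOfInitialDH T.D (analyticLogvVal T.K)).StarPacket v))
    (frobMmod : ∀ (P : NFPoint) (l : ℕ) (T : Cor22.ThetaVolumeDatumAt P l), letI := T.instFieldF; letI := T.instNumberFieldF; letI := T.instAlgebraF; letI := T.instFieldK;
        letI := T.instNumberFieldK; letI := T.instAlgebraK; letI := T.instFieldFbar; letI := T.instAlgebraFbar;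
        letI := T.instAlgebraKFbar; letI := T.instIsElliptic;
      ℤ → ℤ → ∀ j : (thetaIndexOfInitial T.D).LabelStar, Set ((logShellsOfInitialDH T.D (analyticLogvVal T.K)).GlobalPacket j.1))
    (unitImage : ∀ (P : NFPoint) (l : ℕ) (T : Cor22.ThetaVolumeDatumAt P l), letI := T.instFieldF; letI := T.instNumberFieldF; letI := T.instAlgebraF; letI := T.instFieldK;
        letI := T.instNumberFieldK; letI := T.instAlgebraK; letI := T.instFieldFbar; letI := T.instAlgebraFbar;
        letI := T.instAlgebraKFbar; letI := T.instIsElliptic;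
      ℤ → ℤ → ℕ → ∀ (j : (thetaIndexOfInitial T.D).Label) (vQ : (thetaIndexOfInitial T.D).VQ), Set ((logShellsOfInitialDH T.D (analyticLogvVal T.K)).Packet j vQ))
    (ballImage : ∀ (P : NFPoint) (l : ℕ) (T : Cor22.ThetaVolumeDatumAt P l), letI := T.instFieldF; letI := T.instNumberFieldF; letI := T.instAlgebraF; letI := T.instFieldK;
        letI := T.instNumberFieldK; letI := T.instAlgebraK; letI := T.instFieldFbar; letI := T.instAlgebraFbar;
        letI := T.instAlgebraKFbar; letI := T.instIsElliptic;
      ℤ → ℤ → ∀ (j : (thetaIndexOfInitial T.D).Label) (vQ : (thetaIndexOfInitial T.D).VQ), Set ((logShellsOfInitialDH T.D (analyticLogvVal T.K)).Packet j vQ))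
    (thetaDiv : ∀ (P : NFPoint) (l : ℕ) (T : Cor22.ThetaVolumeDatumAt P l), letI := T.instFieldF; letI := T.instNumberFieldF; letI := T.instAlgebraF; letI := T.instFieldK;
        letI := T.instNumberFieldK; letI := T.instAlgebraK; letI := T.instFieldFbar; letI := T.instAlgebraFbar;
        letI := T.instAlgebraKFbar; letI := T.instIsElliptic;
      ℤ → ℤ → LgpDivisor (M P l T) (thetaIndexOfInitial T.D).lstar)
    (n : ∀ (P : NFPoint) (l : ℕ) (T : Cor22.ThetaVolumeDatumAt P l), ℤ)
    {HT : ∀ (P : NFPoint) (l : ℕ) (T : Cor22.ThetaVolumeDatumAt P l), Type} {LogLink : ∀ (P : NFPoint) (l : ℕ) (T : Cor22.ThetaVolumeDatumAt P l), HT P l T → HT P l T → Type}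
    {IsFull : ∀ (P : NFPoint) (l : ℕ) (T : Cor22.ThetaVolumeDatumAt P l), ∀ {s t : HT P l T}, LogLink P l T s t → Prop}
    (lat : ∀ (P : NFPoint) (l : ℕ) (T : Cor22.ThetaVolumeDatumAt P l), LGPGaussianLogThetaLattice (LogLink P l T) (IsFull P l T))
    {Frd : ∀ (P : NFPoint) (l : ℕ) (T : Cor22.ThetaVolumeDatumAt P l), Type} {IsoF : ∀ (P : NFPoint) (l : ℕ) (T : Cor22.ThetaVolumeDatumAt P l), Frd P l T → Frd P l T → Type} {Ob : ∀ (P : NFPoint) (l : ℕ) (T : Cor22.ThetaVolumeDatumAt P l), Frd P l T → Type}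
    {realify : ∀ (P : NFPoint) (l : ℕ) (T : Cor22.ThetaVolumeDatumAt P l), Frd P l T → Frd P l T} {Strip : ∀ (P : NFPoint) (l : ℕ) (T : Cor22.ThetaVolumeDatumAt P l), Type} {IsoS : ∀ (P : NFPoint) (l : ℕ) (T : Cor22.ThetaVolumeDatumAt P l), Strip P l T → Strip P l T → Type}
    {Mv : ∀ (P : NFPoint) (l : ℕ) (T : Cor22.ThetaVolumeDatumAt P l), letI := T.instFieldF; letI := T.instNumberFieldF; letI := T.instAlgebraF; letI := T.instFieldK;
        letI := T.instNumberFieldK; letI := T.instAlgebraK; letI := T.instFieldFbar; letI := T.instAlgebraFbar;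
        letI := T.instAlgebraKFbar; letI := T.instIsElliptic;
      ∀ v : (thetaIndexOfInitial T.D).V, v ∈ (thetaIndexOfInitial T.D).Vbad → Type}
    [∀ P l T v h, Monoid (Mv P l T v h)]
    (sig : ∀ (P : NFPoint) (l : ℕ) (T : Cor22.ThetaVolumeDatumAt P l), letI := T.instFieldF; letI := T.instNumberFieldF; letI := T.instAlgebraF; letI := T.instFieldK;
        letI := T.instNumberFieldK; letI := T.instAlgebraK; letI := T.instFieldFbar; letI := T.instAlgebraFbar;
        letI := T.instAlgebraKFbar; letI := T.instIsElliptic;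
      GlobalLGPFrobenioidSignature (thetaIndexOfInitial T.D).lstar (thetaIndexOfInitial T.D).V (· ∈ (thetaIndexOfInitial T.D).Vbad) (Frd P l T) (IsoF P l T) (Ob P l T) (realify P l T)
        (Strip P l T) (IsoS P l T) (Mv P l T))
    (split : ∀ (P : NFPoint) (l : ℕ) (T : Cor22.ThetaVolumeDatumAt P l), SplittingMonoids (Mv P l T))
    {ObΔ : ∀ (P : NFPoint) (l : ℕ) (T : Cor22.ThetaVolumeDatumAt P l), Type}
    {N : ∀ (P : NFPoint) (l : ℕ) (T : Cor22.ThetaVolumeDatumAt P l), letI := T.instFieldF; letI := T.instNumberFieldF; letI := T.instAlgebraF; letI := T.instFieldK;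
        letI := T.instNumberFieldK; letI := T.instAlgebraK; letI := T.instFieldFbar; letI := T.instAlgebraFbar;
        letI := T.instAlgebraKFbar; letI := T.instIsElliptic;
      ∀ v : (thetaIndexOfInitial T.D).V, v ∈ (thetaIndexOfInitial T.D).Vbad → Type}
    [∀ P l T v h, Monoid (N P l T v h)] (qData : ∀ (P : NFPoint) (l : ℕ) (T : Cor22.ThetaVolumeDatumAt P l), QPilotData (ObΔ P l T) (N P l T))
    (qK : ∀ (P : NFPoint) (l : ℕ) (T : Cor22.ThetaVolumeDatumAt P l), letI := T.instFieldF; letI := T.instNumberFieldF; letI := T.instAlgebraF; letI := T.instFieldK;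
        letI := T.instNumberFieldK; letI := T.instAlgebraK; letI := T.instFieldFbar; letI := T.instAlgebraFbar;
        letI := T.instAlgebraKFbar; letI := T.instIsElliptic;
      ∀ v : (thetaIndexOfInitial T.D).V, v ∈ (thetaIndexOfInitial T.D).Vbad → Set ((logShellsOfInitialDH T.D (analyticLogvVal T.K)).StarPacket v))
    (h6 : Cor22.CondP6 (ratPoint (((2 : ℕ) : ℚ) / (23 ^ 5 : ℕ))) 13) :
    ¬ (∀ (P : NFPoint), P ∈ UP → ∀ (l : ℕ), l.Prime → 5 ≤ l →
      Cor22.AdmitsCore P → Cor22.CondP2 P l → Cor22.CondP5 P l → Cor22.CondP6 P l →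
      (((l : ℝ) + 5) / 4 < (Cor22.dmod P : ℝ) ∨
        6 * l * (((l : ℝ) + 5) - 4 * Cor22.dmod P) / (((l : ℝ) + 4) * ((l : ℝ) - 3))
            * (P.logDiff + (1 - 1 / (l : ℝ)) * Cor22.logCondAvoid P {2, l})
          + 6 * l * ((l : ℝ) + 5) / (((l : ℝ) + 4) * ((l : ℝ) - 3)) * Real.log Real.pi < Cor22.logQAvoid P {2, l}) →
      ∀ (T : Cor22.ThetaVolumeDatumAt P l), letI := T.instFieldF; letI := T.instNumberFieldF; letI := T.instAlgebraF; letI := T.instFieldK;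
        letI := T.instNumberFieldK; letI := T.instAlgebraK; letI := T.instFieldFbar; letI := T.instAlgebraFbar;
        letI := T.instAlgebraKFbar; letI := T.instIsElliptic;
      (¬ ∃ (u : FinitePlace ℚ) (i : Fin (thetaIndexOfInitial T.D).lstar) (x₀ : (thetaIndexOfInitial T.D).Fibre (Val.non u)),
        ((ratChar u : ℕ) : ℝ) ^ ((((i : ℕ) : ℝ) + 2) *
        (differentOrd (ratChar u) (kOfM T.D (ratChar u) u (natCast_ratChar_mem u) x₀)
        + logRadiusA (ratChar u) (absRamificationIdx (ratChar u) (kOfM T.D (ratChar u) u (natCast_ratChar_mem u) x₀))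
        + logRadiusB (ratChar u) (absRamificationIdx (ratChar u) (kOfM T.D (ratChar u) u (natCast_ratChar_mem u) x₀))) + 1) *
        ‖tqM T.D (ratChar u) u (natCast_ratChar_mem u) (ideleDataOf T.D T.isVolumeInputOf) x₀‖ ^ (((i : ℕ) + 1) ^ 2 - 1) < 1) →
      Cor312Vol.PilotKummerCompatHull
        (LatticeSituation.ofShells (logShellsOfInitialDH T.D (analyticLogvVal T.K)) (M P l T) (archPk P l T) (archSub P l T)
          (summandPiecesPrM T.D (logvAnalyticVal_analyticLogvVal (K := T.K))).Adm
          (summandPiecesPrM T.D (logvAnalyticVal_analyticLogvVal (K := T.K))).logvol (Ψ P l T) (act P l T) (Mmod P l T)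
          (region P l T) (frobAdm P l T) (frobLogvol P l T) (frobΨ P l T) (frobMmod P l T) (unitImage P l T) (ballImage P l T)
          (thetaDiv P l T))
        (settingPrVolSharpM T.D (logvAnalyticVal_analyticLogvVal (K := T.K)) (tOfIdeleData T.D (ideleDataOf T.D T.isVolumeInputOf))
          (fun u x => tqM T.D (ratChar u) u (natCast_ratChar_mem u) (ideleDataOf T.D T.isVolumeInputOf) x)
          (M P l T) (archPk P l T) (archSub P l T) (Ψ P l T) (act P l T)
          (Mmod P l T) (region P l T) (n P l T) (lat P l T) (sig P l T) (split P l T) (qData P l T)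
          (fun u x => tqM_ne_zero T.D (ratChar u) u (natCast_ratChar_mem u) (ideleDataOf T.D T.isVolumeInputOf) x)
          (GenuineM.finite_ratPlaces_under_S T.D).toFinset
          (fun u x hu => norm_tqM_eq_one_of_not_mem T.D (ratChar u) u (natCast_ratChar_mem u) (ideleDataOf T.D T.isVolumeInputOf) x
            fun hx => hu ((Set.Finite.mem_toFinset _).mpr ⟨x, hx⟩))) 
        (fun _ => Cor312.Setting.qRegion
        (settingPrVolSharpM T.D (logvAnalyticVal_analyticLogvVal (K := T.K)) (tOfIdeleData T.D (ideleDataOf T.D T.isVolumeInputOf))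
          (fun u x => tqM T.D (ratChar u) u (natCast_ratChar_mem u) (ideleDataOf T.D T.isVolumeInputOf) x)
          (M P l T) (archPk P l T) (archSub P l T) (Ψ P l T) (act P l T)
          (Mmod P l T) (region P l T) (n P l T) (lat P l T) (sig P l T) (split P l T) (qData P l T)
          (fun u x => tqM_ne_zero T.D (ratChar u) u (natCast_ratChar_mem u) (ideleDataOf T.D T.isVolumeInputOf) x)
          (GenuineM.finite_ratPlaces_under_S T.D).toFinset
          (fun u x hu => norm_tqM_eq_one_of_not_mem T.D (ratChar u) u (natCast_ratChar_mem u) (ideleDataOf T.D T.isVolumeInputOf) x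
            fun hx => hu ((Set.Finite.mem_toFinset _).mpr ⟨x, hx⟩)))) (qK P l T)) :=
  not_hSHwBad_M_of_refuted M archPk archSub Ψ act Mmod region frobAdm frobLogvol frobΨ frobMmod unitImage ballImage thetaDiv n lat sig split qData qK
    ReyssatM.mem_UP (by norm_num) (by norm_num) ReyssatM.admitsCore ReyssatM.condP2 ReyssatM.condP5 h6 ReyssatM.szpiroBad
    ReyssatM.not_exists_deep_thirteen
    (fun T => GenuineM.not_pilotKummerCompatHull_reyssat_le_19_rad (Or.inl rfl) T (placeOfPrimeQ 23 (by norm_num))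
      (ratChar_placeOfPrimeQ 23 (by norm_num))) (ReyssatM.nonempty_thetaVolumeDatumAt h6)

end Summit.ABC.IUTFork.Conditional

end
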